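import Summits.Ventures.Crystal3D.Theorems.StickyWulffConstantNoReconstructionGainCubicActions
import Summits.Ventures.Crystal3D.Theorems.StickyWulffConstantNoReconstructionGainInterstitialRules
import HarnessLib

/-!
# The cap budget of a moved fcc bond star: the covering radius `45°`, and the budget's easy regimes

HONEST FRAMING. Part of the venture `Summits/Ventures/Crystal3D` (cell `crystal3d-full`), helper
`--supports` the crux `NoReconstructionGain` (stmt-Ventures-19144, route
`route-Ventures-StickyWulffConstant`), line `adhesion` (wulff-p1 g11).  First bricks toward the open
stub `stub_frameCapBudget` of skeleton v12 (the spherical CAP BUDGET of a moved bond star `A U₀`,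
which by `grainFilm_slab_of_capBudget` (`…GrainFrame`) gives the adhesion atom for misoriented fcc
grains at every normal):

* `exists_fcc_unit_inner_ge` — **covering radius `45°` of the bond star**: for every unit `w` some
  unit vector `d` of `Λ₀` has `⟪d, w⟫ ≥ √2/2` (cubic coordinates: the two largest of `|A|, |B|, |C|`
  sum to `≥ √2`); `exists_mem_movedStar_inner_ge` — the same for the moved star `A U₀`.
* `real_inner_pos_of_quarter_caps` — unit `u, d, w` with `⟪u, d⟫ ≥ √2/2` and `⟪u, w⟫ > √2/2` have
  `⟪d, w⟫ > 0` (two `45°`-caps about `u`, one open, meet in an open hemisphere).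
* `frameCapBudget_card_le_one` — THE CAP BUDGET FOR AT MOST ONE CONTACT (`#K ≤ 1`, every `t`):
  if `t ≤ √2/2` the star direction within `45°` of `−ν` is steep; if `t > √2/2` the star direction
  within `45°` of `u` is blocked and, by the previous lemma, down.

So a misoriented-grain film each of whose balls touches AT MOST ONE substrate ball gains nothing, at
every normal (with `frameFilm_cross_le_of_capBudget`; the composition is left to the file that lands the
full budget).  Next bricks (not here): for `t ≤ 1/2` two star directions are steep (sorted cubic
coordinates `0 ≤ A ≤ B ≤ C` of `−ν`: `A + C ≥ 1`), for `t ≤ √(2/11)` three are; the budget for two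
contacts above height `1/2` and for three above `√(2/11)` is the genuinely spherical part.

WHAT THIS IS NOT: the budget for two or three contacts is open (numerically it holds with cosine
margin `≥ 0.07`, lead folder `calc/`); rung F-C1 not moved.
-/

noncomputable section

namespace Summit.Ventures.Crystal3D.Theorems

open Summit.Ventures.Crystal3D Finset
open Literature.MathematicalPhysics.StatisticalMechanics (fccStacking barlowPos constHagg orderedContacts
  contactDeficiency)
open scoped InnerProductSpace

/-! ## Cubic coordinates of the three model bonds -/

/-- Inner products of the bonds `u, v, t` with any `w`, in coordinates. -/
theorem inner_bonds_apply (w : EuclideanSpace ℝ (Fin 3)) :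
    ⟪barlowPos 1 (Real.sqrt (2 / 3)) constHagg 0 1 0, w⟫_ℝ = w 0 ∧
    ⟪barlowPos 1 (Real.sqrt (2 / 3)) constHagg 0 0 1, w⟫_ℝ = 1 / 2 * w 0 + Real.sqrt 3 / 2 * w 1 ∧
    ⟪barlowPos 1 (Real.sqrt (2 / 3)) constHagg 1 0 0, w⟫_ℝ =
      1 / 2 * w 0 + Real.sqrt 3 / 6 * w 1 + Real.sqrt (2 / 3) * w 2 := by
  obtain ⟨⟨u0, u1, u2⟩, ⟨v0, v1, v2⟩, ⟨t0, t1, t2⟩⟩ := bond_coords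
  refine ⟨?_, ?_, ?_⟩ <;>
    simp only [PiLp.inner_apply, Fin.sum_univ_three, RCLike.inner_apply, conj_trivial, u0, u1, u2, v0, v1,
      v2, t0, t1, t2] <;> ring

/-- For reals with `A² + B² + C² = 2`: the two of largest modulus sum to at least `√2`. -/
theorem exists_pair_abs_add_ge_sqrt_two (A B C : ℝ) (h : A ^ 2 + B ^ 2 + C ^ 2 = 2) :
    Real.sqrt 2 ≤ |A| + |B| ∨ Real.sqrt 2 ≤ |A| + |C| ∨ Real.sqrt 2 ≤ |B| + |C| := by
  have key : ∀ X Y Z : ℝ, X ^ 2 + Y ^ 2 + Z ^ 2 = 2 → |Z| ≤ |X| → |Z| ≤ |Y| → Real.sqrt 2 ≤ |X| + |Y| := by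
    intro X Y Z hs hzx hzy
    have hprod : Z ^ 2 ≤ |X| * |Y| := by
      rw [← sq_abs Z, sq]; exact mul_le_mul hzx hzy (abs_nonneg Z) (abs_nonneg X)
    have h2 : (2 : ℝ) ≤ (|X| + |Y|) ^ 2 := by
      have := sq_abs X; have := sq_abs Y; nlinarith [sq_abs X, sq_abs Y, sq_nonneg Z]
    calc Real.sqrt 2 ≤ Real.sqrt ((|X| + |Y|) ^ 2) := Real.sqrt_le_sqrt h2
      _ = |X| + |Y| := Real.sqrt_sq (by positivity)
  by_cases hC : |C| ≤ |A| ∧ |C| ≤ |B|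
  · exact Or.inl (key A B C h hC.1 hC.2)
  · by_cases hB : |B| ≤ |A| ∧ |B| ≤ |C|
    · exact Or.inr (Or.inl (key A C B (by linarith) hB.1 hB.2))
    · refine Or.inr (Or.inr (key B C A (by linarith) ?_ ?_))
      · by_contra hlt; push Not at hlt
        rcases not_and_or.1 hB with h1 | h1
        · exact h1 hlt.le
        · push Not at h1
          exact hC ⟨by linarith, h1.le⟩
      · by_contra hlt; push Not at hlt
        rcases not_and_or.1 hC with h1 | h1
        · exact h1 hlt.le
        · push Not at h1
          exact hB ⟨by linarith, h1.le⟩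

/-- **Covering radius `45°` of the bond star.**  For every unit `w` there is a unit vector `d` of
`Λ₀` with `⟪d, w⟫ ≥ √2/2`. -/
theorem exists_fcc_unit_inner_ge (w : EuclideanSpace ℝ (Fin 3)) (hw : ‖w‖ = 1) :
    ∃ d ∈ fccStacking 1 (Real.sqrt (2 / 3)), ‖d‖ = 1 ∧ Real.sqrt 2 / 2 ≤ ⟪d, w⟫_ℝ := by
  obtain ⟨⟨huΛ, hun⟩, ⟨hvΛ, hvn⟩, ⟨htΛ, htn⟩, ⟨huvΛ, huvn⟩, ⟨hutΛ, hutn⟩, ⟨hvtΛ, hvtn⟩⟩ :=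
    bond_mem_and_norm
  obtain ⟨hu, hv, ht⟩ := inner_bonds_apply w
  set u := barlowPos 1 (Real.sqrt (2 / 3)) constHagg 0 1 0 with hudef
  set v := barlowPos 1 (Real.sqrt (2 / 3)) constHagg 0 0 1 with hvdef
  set t := barlowPos 1 (Real.sqrt (2 / 3)) constHagg 1 0 0 with htdef
  -- cubic coordinates
  set A := w 0 + Real.sqrt 3 / 3 * w 1 - Real.sqrt (2 / 3) * w 2 with hA
  set B := w 0 - Real.sqrt 3 / 3 * w 1 + Real.sqrt (2 / 3) * w 2 with hB
  set C := 2 * Real.sqrt 3 / 3 * w 1 + Real.sqrt (2 / 3) * w 2 with hC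
  have h3 : Real.sqrt 3 ^ 2 = 3 := Real.sq_sqrt (by norm_num)
  have h23 : Real.sqrt (2 / 3) ^ 2 = 2 / 3 := Real.sq_sqrt (by norm_num)
  have hw2 : w 0 ^ 2 + w 1 ^ 2 + w 2 ^ 2 = 1 := by
    have := EuclideanSpace.real_norm_sq_eq w
    rw [hw, Fin.sum_univ_three] at this; linarith
  have hp : (Real.sqrt 3 / 3) ^ 2 = 1 / 3 := by rw [div_pow, h3]; norm_num
  have hsum : A ^ 2 + B ^ 2 + C ^ 2 = 2 := by
    rw [hA, hB, hC]
    linear_combination (6 * w 1 ^ 2) * hp + (3 * w 2 ^ 2) * h23 + 2 * hw2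
  have hAB : ⟪u, w⟫_ℝ = (A + B) / 2 := by rw [hu, hA, hB]; ring
  have hAC : ⟪v, w⟫_ℝ = (A + C) / 2 := by rw [hv, hA, hC]; ring
  have hBC : ⟪t, w⟫_ℝ = (B + C) / 2 := by rw [ht, hB, hC]; ring
  -- negatives and differences
  have hneg : ∀ d : EuclideanSpace ℝ (Fin 3), d ∈ fccStacking 1 (Real.sqrt (2 / 3)) → ‖d‖ = 1 →
      -d ∈ fccStacking 1 (Real.sqrt (2 / 3)) ∧ ‖-d‖ = 1 := fun d hd hn => ⟨fcc_neg_mem hd, by rw [norm_neg, hn]⟩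
  rcases exists_pair_abs_add_ge_sqrt_two A B C hsum with hab | hac | hbc
  · -- pair (A, B): `±u` (coords (1,1,0)) or `±(v − t)` (coords (1,−1,0))
    rcases le_total 0 A with ha | ha <;> rcases le_total 0 B with hb | hb
    · refine ⟨u, huΛ, hun, ?_⟩
      rw [hAB]; rw [abs_of_nonneg ha, abs_of_nonneg hb] at hab; linarith
    · refine ⟨v - t, hvtΛ, hvtn, ?_⟩
      rw [inner_sub_left, hAC, hBC]; rw [abs_of_nonneg ha, abs_of_nonpos hb] at hab; linarith
    · refine ⟨-(v - t), (hneg _ hvtΛ hvtn).1, (hneg _ hvtΛ hvtn).2, ?_⟩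
      rw [inner_neg_left, inner_sub_left, hAC, hBC]; rw [abs_of_nonpos ha, abs_of_nonneg hb] at hab; linarith
    · refine ⟨-u, (hneg _ huΛ hun).1, (hneg _ huΛ hun).2, ?_⟩
      rw [inner_neg_left, hAB]; rw [abs_of_nonpos ha, abs_of_nonpos hb] at hab; linarith
  · -- pair (A, C): `±v` (coords (1,0,1)) or `±(u − t)` (coords (1,0,−1))
    rcases le_total 0 A with ha | ha <;> rcases le_total 0 C with hc | hc
    · refine ⟨v, hvΛ, hvn, ?_⟩
      rw [hAC]; rw [abs_of_nonneg ha, abs_of_nonneg hc] at hac; linarith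
    · refine ⟨u - t, hutΛ, hutn, ?_⟩
      rw [inner_sub_left, hAB, hBC]; rw [abs_of_nonneg ha, abs_of_nonpos hc] at hac; linarith
    · refine ⟨-(u - t), (hneg _ hutΛ hutn).1, (hneg _ hutΛ hutn).2, ?_⟩
      rw [inner_neg_left, inner_sub_left, hAB, hBC]; rw [abs_of_nonpos ha, abs_of_nonneg hc] at hac; linarith
    · refine ⟨-v, (hneg _ hvΛ hvn).1, (hneg _ hvΛ hvn).2, ?_⟩
      rw [inner_neg_left, hAC]; rw [abs_of_nonpos ha, abs_of_nonpos hc] at hac; linarith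
  · -- pair (B, C): `±t` (coords (0,1,1)) or `±(u − v)` (coords (0,1,−1))
    rcases le_total 0 B with hb | hb <;> rcases le_total 0 C with hc | hc
    · refine ⟨t, htΛ, htn, ?_⟩
      rw [hBC]; rw [abs_of_nonneg hb, abs_of_nonneg hc] at hbc; linarith
    · refine ⟨u - v, huvΛ, huvn, ?_⟩
      rw [inner_sub_left, hAB, hAC]; rw [abs_of_nonneg hb, abs_of_nonpos hc] at hbc; linarith
    · refine ⟨-(u - v), (hneg _ huvΛ huvn).1, (hneg _ huvΛ huvn).2, ?_⟩
      rw [inner_neg_left, inner_sub_left, hAB, hAC]; rw [abs_of_nonpos hb, abs_of_nonneg hc] at hbc; linarith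
    · refine ⟨-t, (hneg _ htΛ htn).1, (hneg _ htΛ htn).2, ?_⟩
      rw [inner_neg_left, hBC]; rw [abs_of_nonpos hb, abs_of_nonpos hc] at hbc; linarith

/-- **Covering radius `45°` of a moved bond star.**  `U₀` a twelve-element set of unit vectors of
`Λ₀` closed under negation (= the bond star), `A` a linear isometry: every unit `w` is within `45°`
of some member of `A U₀`. -/
theorem exists_mem_movedStar_inner_ge (U₀ : Finset (EuclideanSpace ℝ (Fin 3)))
    (hU₀ : ∀ d ∈ U₀, d ∈ fccStacking 1 (Real.sqrt (2 / 3)) ∧ ‖d‖ = 1) (hU₀card : U₀.card = 12)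
    (A : EuclideanSpace ℝ (Fin 3) ≃ₗᵢ[ℝ] EuclideanSpace ℝ (Fin 3))
    (w : EuclideanSpace ℝ (Fin 3)) (hw : ‖w‖ = 1) :
    ∃ d ∈ U₀.image (fun d => A d), Real.sqrt 2 / 2 ≤ ⟪d, w⟫_ℝ := by
  classical
  have hw' : ‖A.symm w‖ = 1 := by rw [LinearIsometryEquiv.norm_map, hw]
  obtain ⟨d₀, hd₀Λ, hd₀n, hd₀⟩ := exists_fcc_unit_inner_ge (A.symm w) hw'
  refine ⟨A d₀, mem_image.2 ⟨d₀, fcc_unit_mem_of_bondStar U₀ hU₀ hU₀card hd₀Λ hd₀n, rfl⟩, ?_⟩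
  have : ⟪A d₀, w⟫_ℝ = ⟪d₀, A.symm w⟫_ℝ := by
    conv_lhs => rw [← A.apply_symm_apply w]
    rw [LinearIsometryEquiv.inner_map_map]
  rw [this]; exact hd₀

/-- **Two `45°`-caps about a common unit vector, one open, meet in an open hemisphere.**
`‖u‖ = ‖d‖ = ‖w‖ = 1`, `⟪u, d⟫ ≥ √2/2`, `⟪u, w⟫ > √2/2` give `⟪d, w⟫ > 0`. -/
theorem real_inner_pos_of_quarter_caps {u d w : EuclideanSpace ℝ (Fin 3)} (hu : ‖u‖ = 1)
    (hd : ‖d‖ = 1) (hw : ‖w‖ = 1) (hud : Real.sqrt 2 / 2 ≤ ⟪u, d⟫_ℝ) (huw : Real.sqrt 2 / 2 < ⟪u, w⟫_ℝ) :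
    0 < ⟪d, w⟫_ℝ := by
  have h2 : Real.sqrt 2 ^ 2 = 2 := Real.sq_sqrt (by norm_num)
  have hs0 : 0 < Real.sqrt 2 / 2 := by positivity
  set a := ⟪d, u⟫_ℝ with ha
  set b := ⟪w, u⟫_ℝ with hb
  have hau : Real.sqrt 2 / 2 ≤ a := by rw [ha, real_inner_comm]; exact hud
  have hbu : Real.sqrt 2 / 2 < b := by rw [hb, real_inner_comm]; exact huw
  have ha1 : a ≤ 1 := by
    have := abs_real_inner_le_norm d u; rw [hu, hd] at this; exact (abs_le.1 (by linarith)).2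
  have hb1 : b ≤ 1 := by
    have := abs_real_inner_le_norm w u; rw [hu, hw] at this; exact (abs_le.1 (by linarith)).2
  set x := d - a • u with hx
  set y := w - b • u with hy
  have huu : ⟪u, u⟫_ℝ = 1 := by rw [real_inner_self_eq_norm_sq, hu, one_pow]
  have hx2 : ‖x‖ ^ 2 = 1 - a ^ 2 := by
    rw [hx, norm_sub_sq_real, hd, norm_smul, Real.norm_eq_abs, hu, mul_one, sq_abs, inner_smul_right,
      ← ha]; ring
  have hy2 : ‖y‖ ^ 2 = 1 - b ^ 2 := by
    rw [hy, norm_sub_sq_real, hw, norm_smul, Real.norm_eq_abs, hu, mul_one, sq_abs, inner_smul_right,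
      ← hb]; ring
  have hxy : ⟪x, y⟫_ℝ = ⟪d, w⟫_ℝ - a * b := by
    rw [hx, hy, inner_sub_left, inner_sub_right, inner_sub_right, inner_smul_left, inner_smul_right,
      inner_smul_left, inner_smul_right, real_inner_comm w u, ← hb, ← ha, huu]
    simp only [conj_trivial]; ring
  have hcs : |⟪x, y⟫_ℝ| ≤ ‖x‖ * ‖y‖ := abs_real_inner_le_norm x y
  -- `‖x‖ ‖y‖ ≤ (‖x‖² + ‖y‖²)/2 < 1/2` and `a b > 1/2`
  have hamgm : ‖x‖ * ‖y‖ ≤ (‖x‖ ^ 2 + ‖y‖ ^ 2) / 2 := by nlinarith [sq_nonneg (‖x‖ - ‖y‖)]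
  have hxx : ‖x‖ ^ 2 ≤ 1 / 2 := by rw [hx2]; nlinarith
  have hyy : ‖y‖ ^ 2 < 1 / 2 := by rw [hy2]; nlinarith
  have hab : 1 / 2 < a * b := by nlinarith
  linarith [(abs_le.1 (le_trans hcs le_rfl)).1]

/-- **The cap budget for at most one contact** (every `t > 0`): see the module docstring. -/
theorem frameCapBudget_card_le_one (U₀ : Finset (EuclideanSpace ℝ (Fin 3)))
    (hU₀ : ∀ d ∈ U₀, d ∈ fccStacking 1 (Real.sqrt (2 / 3)) ∧ ‖d‖ = 1) (hU₀card : U₀.card = 12)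
    (A : EuclideanSpace ℝ (Fin 3) ≃ₗᵢ[ℝ] EuclideanSpace ℝ (Fin 3))
    (ν : EuclideanSpace ℝ (Fin 3)) (hν : ‖ν‖ = 1) (t : ℝ)
    (K : Finset (EuclideanSpace ℝ (Fin 3))) (hK : K.card ≤ 1)
    (hK1 : ∀ u ∈ K, ‖u‖ = 1 ∧ ⟪u, ν⟫_ℝ ≤ -t) :
    (K.card : ℝ) ≤
      (((U₀.image fun d => A d).filter fun d =>
          ⟪d, ν⟫_ℝ < 0 ∧ ((∃ u ∈ K, 1 / 2 < ⟪u, d⟫_ℝ) ∨ ⟪d, ν⟫_ℝ ≤ -t)).card : ℝ)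
        + (1 / 2) * (((U₀.image fun d => A d).filter fun d =>
          ⟪d, ν⟫_ℝ = 0 ∧ ∃ u ∈ K, 1 / 2 < ⟪u, d⟫_ℝ).card : ℝ) := by
  classical
  set U := U₀.image fun d => A d with hU
  have hU1 : ∀ d ∈ U, ‖d‖ = 1 := by
    intro d hd
    obtain ⟨d₀, hd₀, rfl⟩ := mem_image.1 hd
    rw [LinearIsometryEquiv.norm_map]; exact (hU₀ d₀ hd₀).2
  have h2 : Real.sqrt 2 ^ 2 = 2 := Real.sq_sqrt (by norm_num)
  have hs : (1 : ℝ) / 2 < Real.sqrt 2 / 2 := by nlinarith [Real.sqrt_nonneg 2]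
  have hnn : (0 : ℝ) ≤ (((U.filter fun d => ⟪d, ν⟫_ℝ = 0 ∧ ∃ u ∈ K, 1 / 2 < ⟪u, d⟫_ℝ).card : ℕ) : ℝ) :=
    Nat.cast_nonneg _
  -- it suffices to exhibit one down direction that is steep or blocked
  suffices hex : K.card = 1 → ∃ d ∈ U, ⟪d, ν⟫_ℝ < 0 ∧ ((∃ u ∈ K, 1 / 2 < ⟪u, d⟫_ℝ) ∨ ⟪d, ν⟫_ℝ ≤ -t) by
    rcases Nat.lt_or_ge K.card 1 with h0 | h1
    · have : K.card = 0 := by omega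
      rw [this]; push_cast; linarith [Nat.cast_nonneg (α := ℝ)
        ((U.filter fun d => ⟪d, ν⟫_ℝ < 0 ∧ ((∃ u ∈ K, 1 / 2 < ⟪u, d⟫_ℝ) ∨ ⟪d, ν⟫_ℝ ≤ -t)).card)]
    · have hK1' : K.card = 1 := le_antisymm hK h1
      obtain ⟨d, hdU, hd⟩ := hex hK1'
      have h1le : 1 ≤ (U.filter fun d => ⟪d, ν⟫_ℝ < 0 ∧ ((∃ u ∈ K, 1 / 2 < ⟪u, d⟫_ℝ) ∨ ⟪d, ν⟫_ℝ ≤ -t)).card :=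
        card_pos.2 ⟨d, mem_filter.2 ⟨hdU, hd⟩⟩
      rw [hK1']
      have : (1 : ℝ) ≤ ((U.filter fun d => ⟪d, ν⟫_ℝ < 0 ∧ ((∃ u ∈ K, 1 / 2 < ⟪u, d⟫_ℝ) ∨ ⟪d, ν⟫_ℝ ≤ -t)).card : ℝ) := by
        exact_mod_cast h1le
      push_cast; linarith
  intro hK1'
  obtain ⟨u, hKu⟩ := card_eq_one.1 hK1'
  have huK : u ∈ K := by rw [hKu]; exact mem_singleton_self u
  obtain ⟨hun, huν⟩ := hK1 u huK
  have hnν : ‖-ν‖ = 1 := by rw [norm_neg, hν]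
  by_cases hts : t ≤ Real.sqrt 2 / 2
  · -- the star direction within `45°` of `−ν` is steep
    obtain ⟨d, hdU, hd⟩ := exists_mem_movedStar_inner_ge U₀ hU₀ hU₀card A (-ν) hnν
    rw [inner_neg_right] at hd
    exact ⟨d, hdU, by linarith, Or.inr (by linarith)⟩
  · -- the star direction within `45°` of `u` is blocked, and down
    push Not at hts
    obtain ⟨d, hdU, hd⟩ := exists_mem_movedStar_inner_ge U₀ hU₀ hU₀card A u hun
    have hud : Real.sqrt 2 / 2 ≤ ⟪u, d⟫_ℝ := by rw [real_inner_comm]; exact hd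
    have huw : Real.sqrt 2 / 2 < ⟪u, -ν⟫_ℝ := by rw [inner_neg_right]; linarith
    have hpos := real_inner_pos_of_quarter_caps hun (hU1 d hdU) hnν hud huw
    rw [inner_neg_right] at hpos
    exact ⟨d, hdU, by linarith, Or.inl ⟨u, huK, by linarith⟩⟩

end Summit.Ventures.Crystal3D.Theorems

end
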